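import Summits.KontsevichZagierPeriods.KontsevichZagierPeriods.Theorems.HyperbolicBlochOffTetraSectorKernelGlue
import Summits.KontsevichZagierPeriods.KontsevichZagierPeriods.Theorems.HyperbolicBlochOffTetraSectorKernelRedAll
import Summits.KontsevichZagierPeriods.KontsevichZagierPeriods.Theorems.HyperbolicBlochOffTetraSectorKernelStubSpxSemialgebraic
import Literature.NumberTheory.Transcendental.KZSemiCanonicalReductionProofs
import Literature.NumberTheory.Transcendental.KZCalculusProofs

/-!
# Towards `stub_polytopeEnvelope` — crux `OffTetraSectorKernel`, line `odd-hyperbolic-ladder` (skeleton v5, lead c3)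

Core bookkeeping of the cusp/mesh/cut absorption of rung-2 polytopes into the Bloch–Wigner envelope:
* `polyEnv_iteratedCut` — cutting an admissible simplex by finitely many geodesic half-spaces one at a time
  (hypothesis shape of `stub_simplexCut`) gives an almost-partition into admissible simplices;
* `polyEnv_meshPieces` — a normal-form polytope inside `{|q| < M, t > δ}` is almost-partitioned into admissible
  simplices (mesh of ideal tetrahedra with apex `∞`, hypothesis shape of `stub_meshCover`, then iterated cuts);
* `polyEnv_of_pieces` — a representation whose domain is almost-partitioned into admissible simplices lies in the
  envelope (rule (1a) + the landed `simplex_mem_envelope`).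

References: J. L. Dupont, C.-H. Sah, *Scissors congruences II* (1982), §3; M. Kontsevich, D. Zagier, *Periods*
(2001), §1.2.
-/

noncomputable section

open Set MeasureTheory
open Literature.NumberTheory.Transcendental

namespace Summit.KontsevichZagierPeriods.HyperbolicBloch.OffTetraSectorKernel

section Core

variable {ι : Type*} (S : ι → Set (Fin 3 → ℝ)) (Adm : ι → Prop) (H : (Fin 4 → ℝ) → Set (Fin 3 → ℝ))

/-- **Iterated cuts** (abstract bookkeeping: `S v` the open simplex of the row datum `v`, `Adm` admissibility, `H m`
the half-space of the functional `m`). If every admissible simplex cut by one half-space is almost-partitioned into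
admissible simplices inside it (`stub_simplexCut`), then so is every admissible simplex cut by finitely many
half-spaces. [cite: DupontSah1982, §3] -/
theorem polyEnv_iteratedCut
    (hCut : ∀ v, Adm v → ∀ (m : Fin 4 → ℝ), (∀ c, IsAlgebraic ℚ (m c)) →
      ∃ (N : ℕ) (ws : Fin N → ι), (∀ j, Adm (ws j)) ∧ (∀ j, S (ws j) ⊆ S v ∩ H m) ∧
        (∀ j j', j ≠ j' → S (ws j) ∩ S (ws j') = ∅) ∧ volume ((S v ∩ H m) \ ⋃ j, S (ws j)) = 0) :
    ∀ (K : ℕ) (ms : Fin K → Fin 4 → ℝ), (∀ l c, IsAlgebraic ℚ (ms l c)) → ∀ v, Adm v →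
      ∃ (N : ℕ) (ws : Fin N → ι), (∀ j, Adm (ws j)) ∧ (∀ j, S (ws j) ⊆ S v ∩ {p | ∀ l, p ∈ H (ms l)}) ∧
        (∀ j j', j ≠ j' → S (ws j) ∩ S (ws j') = ∅) ∧
        volume ((S v ∩ {p | ∀ l, p ∈ H (ms l)}) \ ⋃ j, S (ws j)) = 0 := by
  intro K
  induction K with
  | zero =>
    intro ms _ v hv
    refine ⟨1, fun _ => v, fun _ => hv, fun _ => ?_, fun j j' hjj' => absurd (Subsingleton.elim j j') hjj', ?_⟩
    · intro p hp
      exact ⟨hp, fun l => l.elim0⟩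
    · rw [measure_eq_zero_iff_ae_notMem]
      refine Filter.Eventually.of_forall fun p hp => ?_
      exact hp.2 (mem_iUnion.mpr ⟨0, hp.1.1⟩)
  | succ K ih =>
    intro ms hms v hv
    obtain ⟨N, ws, hadm, hsub, hdisj, hcov⟩ := ih (fun l => ms (Fin.castSucc l)) (fun l c => hms _ c) v hv
    choose Nj wss hadm' hsub' hdisj' hcov' using
      fun j => hCut (ws j) (hadm j) (ms (Fin.last K)) (fun c => hms _ c)
    refine ⟨∑ j, Nj j, fun x => wss (finSigmaFinEquiv.symm x).1 (finSigmaFinEquiv.symm x).2,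
      fun x => hadm' _ _, fun x => ?_, fun x x' hxx' => ?_, ?_⟩
    · intro p hp
      have h1 := hsub' _ _ hp
      have h2 := hsub _ h1.1
      refine ⟨h2.1, fun l => ?_⟩
      refine Fin.lastCases ?_ (fun l' => ?_) l
      · exact h1.2
      · exact h2.2 l'
    · dsimp only
      have hab : finSigmaFinEquiv.symm x ≠ finSigmaFinEquiv.symm x' := fun h => hxx' (by simpa using h)
      by_cases hj : (finSigmaFinEquiv.symm x).1 = (finSigmaFinEquiv.symm x').1
      · -- same first-stage piece, different second-stage pieces
        generalize ha : finSigmaFinEquiv.symm x = a at hab hj ⊢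
        generalize hb : finSigmaFinEquiv.symm x' = b at hab hj ⊢
        obtain ⟨j, i⟩ := a
        obtain ⟨j', i'⟩ := b
        simp only at hj
        subst hj
        have hii : i ≠ i' := fun h => hab (by subst h; rfl)
        exact hdisj' j i i' hii
      · have hd := hdisj _ _ hj
        refine eq_empty_of_subset_empty fun p hp => ?_
        rw [← hd]
        exact ⟨(hsub' _ _ hp.1).1, (hsub' _ _ hp.2).1⟩
    · -- cover: first-stage null part, plus the null parts of every cut
      have hT : (S v ∩ {p | ∀ l, p ∈ H (ms l)}) \
          ⋃ x : Fin (∑ j, Nj j), S (wss (finSigmaFinEquiv.symm x).1 (finSigmaFinEquiv.symm x).2) ⊆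
          ((S v ∩ {p | ∀ l, p ∈ H (ms (Fin.castSucc l))}) \ ⋃ j, S (ws j)) ∪
          ⋃ j, ((S (ws j) ∩ H (ms (Fin.last K))) \ ⋃ i, S (wss j i)) := by
        intro p hp
        obtain ⟨⟨hpv, hpl⟩, hnot⟩ := hp
        rw [mem_iUnion, not_exists] at hnot
        by_cases hj : ∃ j, p ∈ S (ws j)
        · obtain ⟨j, hj⟩ := hj
          refine Or.inr (mem_iUnion.mpr ⟨j, ⟨hj, hpl (Fin.last K)⟩, ?_⟩)
          rw [mem_iUnion, not_exists]
          intro i hi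
          refine hnot (finSigmaFinEquiv ⟨j, i⟩) ?_
          rw [Equiv.symm_apply_apply]
          exact hi
        · rw [not_exists] at hj
          exact Or.inl ⟨⟨hpv, fun l => hpl _⟩, by rwa [mem_iUnion, not_exists]⟩
      refine measure_mono_null hT (measure_union_null hcov ?_)
      exact measure_iUnion_null fun j => hcov' j

/-- **Mesh, then cut.** A set `Q = {0 < t} ∩ ⋂ₗ H (ms l)` inside the box `{|q| < M, δ < t}` is almost-partitioned
into admissible simplices inside it: mesh the box by admissible simplices (`stub_meshCover`), then cut every mesh
simplex by the constraints (`polyEnv_iteratedCut`). Here `S v ⊆ {0 < t}` is assumed for mesh simplices.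
[cite: DupontSah1982, §3] -/
theorem polyEnv_meshPieces
    (hCut : ∀ v, Adm v → ∀ (m : Fin 4 → ℝ), (∀ c, IsAlgebraic ℚ (m c)) →
      ∃ (N : ℕ) (ws : Fin N → ι), (∀ j, Adm (ws j)) ∧ (∀ j, S (ws j) ⊆ S v ∩ H m) ∧
        (∀ j j', j ≠ j' → S (ws j) ∩ S (ws j') = ∅) ∧ volume ((S v ∩ H m) \ ⋃ j, S (ws j)) = 0)
    (hMesh : ∀ (M δ : ℝ), 0 < M → 0 < δ → ∃ (m : ℕ) (vs : Fin m → ι), (∀ j, Adm (vs j)) ∧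
      (∀ j, S (vs j) ⊆ {p | 0 < p 2}) ∧ (∀ j j', j ≠ j' → S (vs j) ∩ S (vs j') = ∅) ∧
      volume ({p : Fin 3 → ℝ | p 0 ^ 2 + p 1 ^ 2 < M ^ 2 ∧ δ < p 2} \ ⋃ j, S (vs j)) = 0)
    (K : ℕ) (ms : Fin K → Fin 4 → ℝ) (hms : ∀ l c, IsAlgebraic ℚ (ms l c)) (Q : Set (Fin 3 → ℝ))
    (hQ : Q = {p | 0 < p 2 ∧ ∀ l, p ∈ H (ms l)}) (M δ : ℝ) (hM : 0 < M) (hδ : 0 < δ)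
    (hbox : Q ⊆ {p | p 0 ^ 2 + p 1 ^ 2 < M ^ 2 ∧ δ < p 2}) :
    ∃ (N : ℕ) (ws : Fin N → ι), (∀ j, Adm (ws j)) ∧ (∀ j, S (ws j) ⊆ Q) ∧
      (∀ j j', j ≠ j' → S (ws j) ∩ S (ws j') = ∅) ∧ volume (Q \ ⋃ j, S (ws j)) = 0 := by
  obtain ⟨m, vs, hadm, hpos, hdisj, hcov⟩ := hMesh M δ hM hδ
  choose Nj wss hadm' hsub' hdisj' hcov' using
    fun j => polyEnv_iteratedCut S Adm H hCut K ms hms (vs j) (hadm j)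
  refine ⟨∑ j, Nj j, fun x => wss (finSigmaFinEquiv.symm x).1 (finSigmaFinEquiv.symm x).2,
    fun x => hadm' _ _, fun x => ?_, fun x x' hxx' => ?_, ?_⟩
  · intro p hp
    have h1 := hsub' _ _ hp
    rw [hQ]
    exact ⟨hpos _ h1.1, h1.2⟩
  · dsimp only
    have hab : finSigmaFinEquiv.symm x ≠ finSigmaFinEquiv.symm x' := fun h => hxx' (by simpa using h)
    by_cases hj : (finSigmaFinEquiv.symm x).1 = (finSigmaFinEquiv.symm x').1
    · generalize ha : finSigmaFinEquiv.symm x = a at hab hj ⊢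
      generalize hb : finSigmaFinEquiv.symm x' = b at hab hj ⊢
      obtain ⟨j, i⟩ := a
      obtain ⟨j', i'⟩ := b
      simp only at hj
      subst hj
      have hii : i ≠ i' := fun h => hab (by subst h; rfl)
      exact hdisj' j i i' hii
    · have hd := hdisj _ _ hj
      refine eq_empty_of_subset_empty fun p hp => ?_
      rw [← hd]
      exact ⟨(hsub' _ _ hp.1).1, (hsub' _ _ hp.2).1⟩
  · have hT : Q \ ⋃ x : Fin (∑ j, Nj j), S (wss (finSigmaFinEquiv.symm x).1 (finSigmaFinEquiv.symm x).2) ⊆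
        ({p : Fin 3 → ℝ | p 0 ^ 2 + p 1 ^ 2 < M ^ 2 ∧ δ < p 2} \ ⋃ j, S (vs j)) ∪
        ⋃ j, ((S (vs j) ∩ {p | ∀ l, p ∈ H (ms l)}) \ ⋃ i, S (wss j i)) := by
      intro p hp
      obtain ⟨hpQ, hnot⟩ := hp
      rw [mem_iUnion, not_exists] at hnot
      by_cases hj : ∃ j, p ∈ S (vs j)
      · obtain ⟨j, hj⟩ := hj
        have hpl : ∀ l, p ∈ H (ms l) := by
          rw [hQ] at hpQ
          exact hpQ.2
        refine Or.inr (mem_iUnion.mpr ⟨j, ⟨hj, hpl⟩, ?_⟩)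
        rw [mem_iUnion, not_exists]
        intro i hi
        refine hnot (finSigmaFinEquiv ⟨j, i⟩) ?_
        rw [Equiv.symm_apply_apply]
        exact hi
      · rw [not_exists] at hj
        exact Or.inl ⟨hbox hpQ, by rwa [mem_iUnion, not_exists]⟩
    refine measure_mono_null hT (measure_union_null hcov ?_)
    exact measure_iUnion_null fun j => hcov' j

end Core

/-! ### From an almost-partition into admissible simplices to the envelope -/

/-- **Pieces in the envelope.** If the domain of a representation of `t⁻³` is almost-partitioned into finitely many
admissible lifted simplices `Spx (ws j)`, then its class lies in the closure of the Bloch–Wigner envelope: rule (1a)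
(`KZ.of_sub_sum_of_mem_relations`) and the landed `simplex_mem_envelope` for every piece. [cite: DupontSah1982, §3] -/
theorem polyEnv_of_pieces :
    ∀ (Ql : (Fin 3 → ℝ) → Fin 4 → ℝ), (∀ p, Ql p = ![p 0 ^ 2 + p 1 ^ 2 + p 2 ^ 2, p 0, p 1, 1]) →
    ∀ (Spx : (Fin 4 → Fin 4 → ℝ) → Set (Fin 3 → ℝ)),
      (∀ v, Spx v = {p | 0 < p 2 ∧ ∀ a, 0 < (Matrix.of v).det * ((Matrix.of v).updateRow a (Ql p)).det}) →
    ∀ (ρ₀ : ℂ → KZ.IntegralRep 3), (∀ z, IsAlgebraic ℚ z → 0 < z.im →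
      (ρ₀ z).domain = idealTetrahedron z ∧ EqOn (ρ₀ z).integrand (fun p => 1 / p 2 ^ 3) (idealTetrahedron z)) →
    ∀ (r : KZ.IntegralRep 3), EqOn r.integrand (fun p => 1 / p 2 ^ 3) r.domain →
    ∀ (N : ℕ) (ws : Fin N → Fin 4 → Fin 4 → ℝ),
      (∀ j, (∀ i c, IsAlgebraic ℚ (ws j i c)) ∧
        (∀ i, (ws j i 1 ^ 2 + ws j i 2 ^ 2 = ws j i 0 * ws j i 3 ∧ 0 ≤ ws j i 3 ∧ 0 < ws j i 0 + ws j i 3) ∨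
          ∃ q : Fin 3 → ℝ, (∀ c, IsAlgebraic ℚ (q c)) ∧ 0 < q 2 ∧ ws j i = Ql q) ∧ (Matrix.of (ws j)).det ≠ 0) →
      (∀ j, Spx (ws j) ⊆ r.domain) → (∀ j j', j ≠ j' → Spx (ws j) ∩ Spx (ws j') = ∅) →
      volume (r.domain \ ⋃ j, Spx (ws j)) = 0 →
      KZ.of r ∈ AddSubgroup.closure {x : KZ.FormalRep | ∃ (k : ℕ) (z : Fin k → ℂ) (e : Fin k → ℤ),
        (∀ i, IsAlgebraic ℚ (z i)) ∧ (∀ i, 0 < (z i).im) ∧ x - ∑ i, e i • KZ.of (ρ₀ (z i)) ∈ KZ.relations} := by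
  intro Ql hQl Spx hSpx ρ₀ hρ₀ r hr N ws hadm hsub hdisj hcov
  classical
  -- the pieces as restrictions
  have hsa : ∀ j, Literature.ModelTheory.ExponentialFields.IsSemialgebraic ℚ (Spx (ws j)) := fun j =>
    stub_spxSemialgebraic Ql hQl Spx hSpx (ws j) (hadm j).1
  set R : Fin N → KZ.IntegralRep 3 := fun j => r.restrict (Spx (ws j)) (hsa j) (hsub j) with hR
  have hrel : KZ.of r - ∑ j ∈ (Finset.univ : Finset (Fin N)), KZ.of (R j) ∈ KZ.relations := by
    refine KZ.of_sub_sum_of_mem_relations Finset.univ r R (fun j _ => ?_) (fun j _ => ?_) ?_ ?_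
    · simp [hR, Set.sdiff_eq_empty.mpr (hsub j)]
    · intro p _
      rfl
    · simpa [hR] using hcov
    · intro j _ j' _ hjj'
      simp [hR, hdisj j j' hjj']
  have henv : ∀ j, KZ.of (R j) ∈ AddSubgroup.closure {x : KZ.FormalRep | ∃ (k : ℕ) (z : Fin k → ℂ) (e : Fin k → ℤ),
      (∀ i, IsAlgebraic ℚ (z i)) ∧ (∀ i, 0 < (z i).im) ∧ x - ∑ i, e i • KZ.of (ρ₀ (z i)) ∈ KZ.relations} :=
    fun j => AddSubgroup.subset_closure (simplex_mem_envelope Ql hQl Spx hSpx ρ₀ hρ₀ (ws j) (hadm j) (R j) rfl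
      (fun p hp => hr (hsub j hp)))
  have hrel' : KZ.of r - ∑ j, KZ.of (R j) ∈ AddSubgroup.closure {x : KZ.FormalRep |
      ∃ (k : ℕ) (z : Fin k → ℂ) (e : Fin k → ℤ),
      (∀ i, IsAlgebraic ℚ (z i)) ∧ (∀ i, 0 < (z i).im) ∧ x - ∑ i, e i • KZ.of (ρ₀ (z i)) ∈ KZ.relations} :=
    AddSubgroup.subset_closure ⟨0, Fin.elim0, Fin.elim0, fun i => i.elim0, fun i => i.elim0, by simpa using hrel⟩
  have : KZ.of r = (KZ.of r - ∑ j, KZ.of (R j)) + ∑ j, KZ.of (R j) := by abel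
  rw [this]
  exact add_mem hrel' (sum_mem fun j _ => henv j)


end Summit.KontsevichZagierPeriods.HyperbolicBloch.OffTetraSectorKernel

end
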